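import Summits.RiemannHypothesis.RiemannHypothesis.Theorems.HandoffLadderRungs
import HarnessLib

/-!
# HANDOFF — H-ladder rungs at the BANDED-TAIL bandwidths `c = 7/4, 9/5, 19/10` (cell rh-explicit, seat weil-6)

HONEST FRAMING. Nothing here bears on the truth of RH and no certificate is proved here. These are three more rows of the
kernel-implication table of `Theorems/HandoffLadderRungs.lean` (seat theory-2): a custodian-VERIFIED two-sector bracket
`0 ≤ ε_ev(c) ∧ 0 ≤ ε_od(c)` at bandwidth `c` gives `H(q)` for every prime `q < P` with `P ≤ e^{2c}` done in the kernel.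
The bandwidths are those of weil-6's consumer runs (weil-4 engine ktz2l v1.7.2 + weil-6 banded-tail certificates,
HOME/rh-explicit-weil-6/TAILFLOOR.md; EXTREMALS/tailband-*-t7-4-*, -t9-5-*, -t19-10-*):

| `c` | `7/4` | `9/5` | `19/10` |
|---|---|---|---|
| `H(q)` for all primes `q <` | `31` | `31` | `43` |

(`31² = 961 < e⁷`; `31⁵ < e¹⁸` while the next prime `37 > e^{18/5} ≈ 36.6`, so `9/5` adds no prime over `7/4`; `43⁵ < e¹⁹`.) Whether the
hypotheses hold at these `c` is A1's certified numerics (DATA class), not a tree fact.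

References: E. Bombieri, Rend. Mat. Acc. Lincei (9) 11 (2000) §4 (`Bombieri2000Weil`); H. Yoshida, Adv. Stud. Pure Math. 21 (1992) Prop. 6 (`Yoshida1992HermitianForms`).
-/

set_option linter.dupNamespace false  -- the mandated namespace repeats `RiemannHypothesis`

noncomputable section

open Literature.NumberTheory.LFunctions
open Summit.RiemannHypothesis.RiemannHypothesis.Theorems.HandoffLadderRungs

namespace Summit.RiemannHypothesis.RiemannHypothesis.Theorems.HandoffLadderRungsBanded

/-- **`c = 7/4`: `H(q)` for ALL primes `q < 31`**, i.e. the rungs `H(19), H(23), H(29)` from one two-sector certificate at `7/4`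
(`31² = 961 < e⁷`). [folklore] -/
theorem forall_handoffH_of_sector_energies_7_4 (hev : 0 ≤ weilEvenGroundEnergy (7 / 4)) (hod : 0 ≤ weilOddGroundEnergy (7 / 4)) :
    ∀ q : ℕ, q.Prime → q < 31 → HandoffDecomposition.HandoffH q :=
  forall_handoffH_of_sector_energies (by norm_num) (natCast_le_exp_of_pow_lt (n := 2) (m := 7) (by norm_num) (by norm_num) (by norm_num)) hev hod

/-- **`c = 9/5`: `H(q)` for ALL primes `q < 31`** (`31⁵ < e¹⁸`; the next prime `37` exceeds `e^{18/5} ≈ 36.6`). [folklore] -/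
theorem forall_handoffH_of_sector_energies_9_5 (hev : 0 ≤ weilEvenGroundEnergy (9 / 5)) (hod : 0 ≤ weilOddGroundEnergy (9 / 5)) :
    ∀ q : ℕ, q.Prime → q < 31 → HandoffDecomposition.HandoffH q :=
  forall_handoffH_of_sector_energies (by norm_num) (natCast_le_exp_of_pow_lt (n := 5) (m := 18) (by norm_num) (by norm_num) (by norm_num)) hev hod

/-- **`c = 19/10`: `H(q)` for ALL primes `q < 43`**, i.e. additionally `H(31), H(37), H(41)` (`43⁵ < e¹⁹`). [folklore] -/
theorem forall_handoffH_of_sector_energies_19_10 (hev : 0 ≤ weilEvenGroundEnergy (19 / 10)) (hod : 0 ≤ weilOddGroundEnergy (19 / 10)) :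
    ∀ q : ℕ, q.Prime → q < 43 → HandoffDecomposition.HandoffH q :=
  forall_handoffH_of_sector_energies (by norm_num) (natCast_le_exp_of_pow_lt (n := 5) (m := 19) (by norm_num) (by norm_num) (by norm_num)) hev hod

end Summit.RiemannHypothesis.RiemannHypothesis.Theorems.HandoffLadderRungsBanded

end
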